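import Mathlib
import Summits.ResolutionOfSingularities.ResolutionOfSingularities.Theorems.WeightedInvariantLocalWeightedDropNCResSettingPermissible
import Summits.ResolutionOfSingularities.ResolutionOfSingularities.Theorems.WeightedInvariantLocalWeightedDropTOT2NearDim
import Summits.ResolutionOfSingularities.ResolutionOfSingularities.Theorems.WeightedInvariantLocalWeightedDropWildPurePowerUnaryExit

/-!
# `LocalWeightedDrop`, TOT2-LINE inner S-ASM (1): THE REGIMES OF AN ADMISSIBLY DECORATED STATE — apex column (`e^O ≤ 1`), directrix
# form, and the three positions of the new boundary letters against the directrix plane (definitions + the regime split in three letters)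

Crux item stmt-ResolutionOfSingularities-8899 `WeightedInvariant.LocalWeightedDrop` (route `ResolutionOfSingularities/WeightedInvariant`), ENGINE
skeleton v32 (ddb48572591139d5), registered residual `stub_spaceNCRankDrop`; TOT2-LINE v1.3 (res-L1-w43-lead-1 g5, `L/res-L1-w43-lead-1/g5/TOT2-LINE-v1.3.md`).
[OURS · L1 W4.3 · chain w43 · seat res-L1-w43-lead-1 gen 5; over res-L1-w43-stub-1's S-SET (`Decoration`, `Admissible`, `Decoration.c`) and
res-L1-w43-stub-3's near-point vocabulary (invariance vectors of `v ↦ CobordantChart.initEval 1 v c g`).  MODEL: Cossart–Jannsen–Saito LNM 2270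
(2020) §3 (`Dir^O`, `e^O`, the transversality `N(x) ⋔ Dir^O_x(X)` of condition (4e) of Thm 5.28) read on the `I₃`-product `g = f · ∏_{l∈O} x_l` of the
programme's own count game; nothing here is a statement of any manuscript; AI-produced, gate-checked, weaker than expert review.]

WHY.  res-L1-w43-stub-1's outer assembly (`…NCResPhaseAssemblyEnd.spaceNCRankDrop_of_highPhase`) reduced the registered stub to the `o ≥ 2`
HEAD PHASE `hhigh`: from every admissibly decorated position with `2 ≤ o` the mover forces an admissibly decorated position of smaller head
`(o, c)`.  The inner composition of that phase runs by REGIMES of the state, read on the degree-`c` form of `g = f · ∏_{l ∈ O} x_l`: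
* `Decoration.IsInv δ v` — `v` is a translation-invariance vector of that form (the vectors of `Dir(in_c g) = Dir^O`);
* `Decoration.HCol δ` — every two invariance vectors are dependent (`e^O ≤ 1`; the binder `hcol` of res-type-056's
  `TOT2E1.dWinsTo_headDrop_of_apexLEOne`, verbatim);
* `Decoration.IsDirForm δ ℓ` — `in_c g = λ · (ℓ · v)^c` with `ℓ ≠ 0`, `λ ≠ 0` (`e^O = 2`: the directrix is the plane `ℓ = 0`);
* for `O = ∅` the position of the boundary letters `E` (all new) against the directrix plane: `Decoration.GoodDir` (some letter outside `E` occurs in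
  `ℓ`: the letters and `ℓ` are part of one coordinate system — CJS's `N ⋔ Dir`), `Decoration.BadDir` (`ℓ` is spanned by at least two boundary
  letters), `Decoration.LetterDir δ l` (`ℓ` IS the boundary letter `x_l`);
* `Decoration.isInv_of_isDirForm`, `Decoration.isDirForm_single_of_support` — bookkeeping;
* **`Decoration.exists_isDirForm_of_not_hCol`** — in three letters, `¬ HCol` gives a directrix form (`WildPurePower.cone_eq_of_wide` + `λ ≠ 0`
  from `TOT2Near.order_ne_of_forall_inv`);
* **`Decoration.regime_split`** — in three letters an admissible state with `2 ≤ o` and `¬ HCol` has `O ≠ ∅`, or is `GoodDir`, or `BadDir`, or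
  `LetterDir l` for some `l` — the case list of the inner S-ASM (TOT2-LINE v1.3 §2).
-/

set_option linter.dupNamespace false -- mandated namespace of this single-conjunct summit

noncomputable section

namespace Summit.ResolutionOfSingularities.ResolutionOfSingularities.Theorems

namespace TameFourTupleDrop

open MvPowerSeries Literature.AlgebraicGeometry.Resolution

variable {k : Type} [Field k] {m : ℕ}

namespace Decoration

/-! ## Invariance vectors of the degree-`c` form of the `I₃`-product, the apex column, directrix forms -/

/-- `v` is a TRANSLATION-INVARIANCE VECTOR of the degree-`c` form of `g = f · ∏_{l ∈ O} x_l` (a vector of `Dir^O`, written as a function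
identity as in the near-point files). -/
def IsInv (δ : Decoration k m) (v : Fin (m + 1) → k) : Prop :=
  ∀ x : Fin (m + 1) → k, CobordantChart.initEval (fun _ : Fin (m + 1) => 1) (x + v) δ.c (δ.f * ∏ l ∈ δ.O, X l) =
    CobordantChart.initEval (fun _ : Fin (m + 1) => 1) x δ.c (δ.f * ∏ l ∈ δ.O, X l)

/-- THE APEX COLUMN REGIME `e^O ≤ 1`: every two invariance vectors of the degree-`c` form of `f · ∏_{l ∈ O} x_l` are linearly dependent (the
hypothesis `hcol` of `TOT2E1.dWinsTo_headDrop_of_apexLEOne`, verbatim). -/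
def HCol (δ : Decoration k m) : Prop :=
  ∀ v₁ v₂ : Fin (m + 1) → k, δ.IsInv v₁ → δ.IsInv v₂ → ∃ α β : k, (α ≠ 0 ∨ β ≠ 0) ∧ α • v₁ + β • v₂ = 0

/-- `ℓ` is a DIRECTRIX FORM of the state: the degree-`c` form of `f · ∏_{l ∈ O} x_l` is `λ · (ℓ · v)^c` with `ℓ ≠ 0` and `λ ≠ 0` (`e^O = 2`,
directrix plane `ℓ = 0`). -/
def IsDirForm (δ : Decoration k m) (ℓ : Fin (m + 1) → k) : Prop :=
  ℓ ≠ 0 ∧ ∃ la : k, la ≠ 0 ∧ ∀ v : Fin (m + 1) → k,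
    CobordantChart.initEval (fun _ : Fin (m + 1) => 1) v δ.c (δ.f * ∏ l ∈ δ.O, X l) = la * dotProduct ℓ v ^ δ.c

/-- GOOD POSITION (`O = ∅`): some directrix form involves a coordinate that is NOT a boundary letter — the boundary letters together with `ℓ` are
part of one coordinate system (CJS's transversality `N ⋔ Dir`). -/
def GoodDir (δ : Decoration k m) : Prop :=
  δ.O = ∅ ∧ ∃ ℓ : Fin (m + 1) → k, δ.IsDirForm ℓ ∧ ∃ j : Fin (m + 1), j ∉ δ.E ∧ ℓ j ≠ 0

/-- BAD POSITION (`O = ∅`): some directrix form is spanned by boundary letters and involves at least two of them (the directrix plane contains the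
intersection of two boundary components: not transversal). -/
def BadDir (δ : Decoration k m) : Prop :=
  δ.O = ∅ ∧ ∃ ℓ : Fin (m + 1) → k, δ.IsDirForm ℓ ∧ (∀ j, ℓ j ≠ 0 → j ∈ δ.E) ∧ ∃ j j' : Fin (m + 1), j ≠ j' ∧ ℓ j ≠ 0 ∧ ℓ j' ≠ 0

/-- LETTER DIRECTRIX (`O = ∅`): the directrix plane IS the (new) boundary component `x_l = 0`. -/
def LetterDir (δ : Decoration k m) (l : Fin (m + 1)) : Prop :=
  δ.O = ∅ ∧ l ∈ δ.E ∧ δ.IsDirForm (Pi.single l 1)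

/-! ## Bookkeeping -/

/-- A vector in the directrix plane of a directrix form is an invariance vector. -/
theorem isInv_of_isDirForm {δ : Decoration k m} {ℓ : Fin (m + 1) → k} (h : δ.IsDirForm ℓ) {v : Fin (m + 1) → k}
    (hv : dotProduct ℓ v = 0) : δ.IsInv v := by
  obtain ⟨-, la, -, hcone⟩ := h
  intro x
  rw [hcone, hcone, dotProduct_add, hv, add_zero]

/-- A directrix form supported on one coordinate may be replaced by that coordinate's unit vector. -/
theorem isDirForm_single_of_support {δ : Decoration k m} {ℓ : Fin (m + 1) → k} (h : δ.IsDirForm ℓ) {l : Fin (m + 1)}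
    (hsupp : ∀ j, j ≠ l → ℓ j = 0) : δ.IsDirForm (Pi.single l 1) := by
  obtain ⟨hℓ, la, hla, hcone⟩ := h
  have hl : ℓ l ≠ 0 := by
    intro h0
    apply hℓ
    funext j
    by_cases hj : j = l
    · rw [hj, h0]; rfl
    · exact hsupp j hj
  refine ⟨?_, la * ℓ l ^ δ.c, mul_ne_zero hla (pow_ne_zero _ hl), fun v => ?_⟩
  · intro h0
    have := congr_fun h0 l
    simp at this
  have hdot : dotProduct ℓ v = ℓ l * v l := by
    rw [dotProduct]
    rw [Finset.sum_eq_single l (fun j _ hj => by rw [hsupp j hj, zero_mul]) (fun h => absurd (Finset.mem_univ l) h)]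
  rw [hcone, hdot, single_one_dotProduct, mul_pow, mul_assoc]

/-! ## In three letters: a directrix form exists outside the apex column, and the regime split -/

/-- **`¬ HCol` ⇒ a directrix form exists** (three letters, admissible state with `2 ≤ o`): two independent invariance vectors make the degree-`c`
form `λ · (ℓ · v)^c` (`WildPurePower.cone_eq_of_wide`), and `λ ≠ 0` because the form of a germ of order exactly `c > 0` is not invariant under
every vector (`TOT2Near.order_ne_of_forall_inv`). -/
theorem exists_isDirForm_of_not_hCol [Infinite k] {b : MvPowerSeries (Fin (2 + 1)) k} {δ : Decoration k 2} (hadm : Admissible b δ)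
    (ho : 2 ≤ δ.o) (h : ¬ δ.HCol) : ∃ ℓ : Fin (2 + 1) → k, δ.IsDirForm ℓ := by
  unfold HCol at h
  push Not at h
  obtain ⟨v₁, v₂, h₁, h₂, hind⟩ := h
  have hind' : ∀ α β : k, α • v₁ + β • v₂ = 0 → α = 0 ∧ β = 0 := by
    intro α β hαβ
    by_contra hne
    exact hind α β (by tauto) hαβ
  have h₁' : ∀ v : Fin 3 → k, CobordantChart.initEval (fun _ : Fin 3 => 1) (v + v₁) δ.c (δ.f * ∏ l ∈ δ.O, X l) =
      CobordantChart.initEval (fun _ : Fin 3 => 1) v δ.c (δ.f * ∏ l ∈ δ.O, X l) := h₁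
  have h₂' : ∀ v : Fin 3 → k, CobordantChart.initEval (fun _ : Fin 3 => 1) (v + v₂) δ.c (δ.f * ∏ l ∈ δ.O, X l) =
      CobordantChart.initEval (fun _ : Fin 3 => 1) v δ.c (δ.f * ∏ l ∈ δ.O, X l) := h₂
  obtain ⟨la, ℓ, hℓ, hcone⟩ := WildPurePower.cone_eq_of_wide (δ.f * ∏ l ∈ δ.O, X l) δ.c v₁ v₂ hind' h₁' h₂'
  refine ⟨ℓ, hℓ, la, ?_, hcone⟩
  intro hla
  have hc : 0 < δ.c := by unfold Decoration.c; omega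
  refine TOT2Near.order_ne_of_forall_inv hc (f := δ.f * ∏ l ∈ δ.O, X l) (fun u v => ?_)
    (by rw [Decoration.order_totalO hadm])
  rw [hcone, hcone, hla, zero_mul, zero_mul]

/-- **THE REGIME SPLIT** (three letters): an admissible state with `2 ≤ o` outside the apex column has a non-empty history, or is in good position, or
in bad position, or its directrix is a boundary letter. -/
theorem regime_split [Infinite k] {b : MvPowerSeries (Fin (2 + 1)) k} {δ : Decoration k 2} (hadm : Admissible b δ) (ho : 2 ≤ δ.o)
    (h : ¬ δ.HCol) : δ.O.Nonempty ∨ δ.GoodDir ∨ δ.BadDir ∨ ∃ l, δ.LetterDir l := by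
  classical
  obtain ⟨ℓ, hℓ⟩ := exists_isDirForm_of_not_hCol hadm ho h
  rcases Finset.eq_empty_or_nonempty δ.O with hO | hO
  · right
    by_cases hgood : ∃ j : Fin (2 + 1), j ∉ δ.E ∧ ℓ j ≠ 0
    · exact Or.inl ⟨hO, ℓ, hℓ, hgood⟩
    push Not at hgood
    have hsupp : ∀ j, ℓ j ≠ 0 → j ∈ δ.E := fun j hj => by
      by_contra hjE
      exact hj (hgood j hjE)
    right
    by_cases hbad : ∃ j j' : Fin (2 + 1), j ≠ j' ∧ ℓ j ≠ 0 ∧ ℓ j' ≠ 0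
    · exact Or.inl ⟨hO, ℓ, hℓ, hsupp, hbad⟩
    push Not at hbad
    right
    obtain ⟨l, hl⟩ : ∃ l, ℓ l ≠ 0 := by
      by_contra hall
      push Not at hall
      exact hℓ.1 (funext hall)
    refine ⟨l, hO, hsupp l hl, isDirForm_single_of_support hℓ fun j hj => ?_⟩
    by_contra hj0
    exact hl (hbad j l hj hj0)
  · exact Or.inl hO

end Decoration

end TameFourTupleDrop

end Summit.ResolutionOfSingularities.ResolutionOfSingularities.Theorems

end
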